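import Mathlib
import Summits.MatrixMultiplication.MatrixMultiplication.Theorems.SubgroupIdentityDesigns.Negative.FamilyADesign

/-!
# The slice `{g ∈ GL₂(𝔽_p) : (g w)₁ = 1}` is an interpolation set for level-one functions — all primes `p`

(cell B2b-5, crux `SubgroupIdentityDesigns` = stmt-MatrixMultiplication-14079, gen 8; companion of `FamilyA`,
`FamilyADesign`; report `run/shared/lean/b2b/levelgraded-cu/ORACLE-g8.md` §G8-2b).  VALUE = an all-`p` structure
theorem behind the census numerics, NOT summit progress (the crux item stays open; `m = 2` cannot give `ε → 0`).

`FamilyADesign` exhibits ONE level-one function `F` with `F(1) = p` and `F = 0` on `S ∖ {1}`, where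
`S = {g : g₀₀ + g₀₁ = 1} = {g : (g w)₁ = 1}`, `w = (1,1)ᵀ` (size `p²(p−1)`).  Here we upgrade this to:

* `slice_interpolation` — EVERY function `φ : S → ℂ` is the restriction of a level-one function; equivalently
* `annihilator_trivial` — no nonzero linear functional supported on `S` annihilates the level-one functions
  (the "full row rank `|S|`" observed numerically for `p ≤ 23` by kit job j078065 of the cell, now for all `p`).

Mechanism (no Fourier analysis needed): `S = P · Stab(w)` is a single double coset of the row group
`P = {h : e₁ᵀ h = e₁ᵀ}` and the stabiliser of `w`, and the level-one functions are stable under two-sided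
translation `f ↦ f(a · b)` (a translated fibre indicator is a fibre indicator, `fib_translate`).  For `s ∈ S` put
`t = s₁₀ + s₁₁` and `h_t = (1,0; t−1,1)` (so `h_t w = s w = (1,t)ᵀ`); the map `T_s : g ↦ h_t⁻¹ g s⁻¹ h_t` fixes the
slice, sends `s ↦ 1` and nothing else to `1`, hence `F ∘ T_s` is a level-one function equal to `p·δ_s` on `S`
(`Fpt_self`, `Fpt_other`).  Summing `φ(s) p⁻¹ · F ∘ T_s` over `s ∈ S` interpolates `φ`.
Consequences recorded in ORACLE-g8 §G8-2b: identity designs on `S` exist for every target pattern, the design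
problem for any triple with `H₁H₂H₃ ⊆ S` is unobstructed, and `|S| = p³ − p²` against `dim F₁|GL₂ = D₁(p) = p³ + p² − 3p − 1`
(`GlobalRelations`; `1418` at `p = 11`) is an equality of "interpolation type" up to `O(p²)`.
-/

set_option linter.dupNamespace false

open scoped BigOperators
open Summit.MatrixMultiplication.MatrixMultiplication.Theorems.LieRankDesigns.Negative (GLm Mat fourierFn levelSet)
open Summit.MatrixMultiplication.MatrixMultiplication.Theorems.LieRankDesigns.LevelOfFixedVector
  (smul_mem_levelSet sum_mem_levelSet add_mem_levelSet)

namespace Summit.MatrixMultiplication.MatrixMultiplication.Theorems.SubgroupIdentityDesigns.Negative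
namespace FamilyAInterp

open FamilyADesign

variable {p : ℕ} [hp : Fact p.Prime]

/-- `a X = v ↔ X = a⁻¹ v` for `a ∈ GL₂`. -/
theorem mulVec_eq_iff (a : GLm p 2) (X v : Fin 2 → ZMod p) :
    (a : Mat p 2).mulVec X = v ↔ X = ((a⁻¹ : GLm p 2) : Mat p 2).mulVec v := by
  constructor
  · rintro rfl
    rw [Matrix.mulVec_mulVec, Units.inv_mul, Matrix.one_mulVec]
  · rintro rfl
    rw [Matrix.mulVec_mulVec, Units.mul_inv, Matrix.one_mulVec]

omit hp in
/-- `(a g b) u = a (g (b u))`. -/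
theorem mulVec_mul3 (a g b : GLm p 2) (u : Fin 2 → ZMod p) :
    ((a * g * b : GLm p 2) : Mat p 2).mulVec u =
      (a : Mat p 2).mulVec ((g : Mat p 2).mulVec ((b : Mat p 2).mulVec u)) := by
  simp only [Units.val_mul, ← Matrix.mulVec_mulVec]

/-- A translated fibre indicator is a fibre indicator: `[(agb) u = v] = [g (b u) = a⁻¹ v]`. -/
theorem fib_translate (u v : Fin 2 → ZMod p) (a b g : GLm p 2) :
    fib u v (a * g * b) = fib ((b : Mat p 2).mulVec u) (((a⁻¹ : GLm p 2) : Mat p 2).mulVec v) g := by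
  unfold fib
  by_cases h : (g : Mat p 2).mulVec ((b : Mat p 2).mulVec u) = ((a⁻¹ : GLm p 2) : Mat p 2).mulVec v
  · have h' : ((a * g * b : GLm p 2) : Mat p 2).mulVec u = v := by
      rw [mulVec_mul3, mulVec_eq_iff]; exact h
    rw [if_pos h', if_pos h]
  · have h' : ¬ ((a * g * b : GLm p 2) : Mat p 2).mulVec u = v := by
      rw [mulVec_mul3, mulVec_eq_iff]; exact h
    rw [if_neg h', if_neg h]

/-- Two-sided translates of `F` are level-one functions. -/
theorem F_translate_mem (a b : GLm p 2) : (fun g => F (a * g * b)) ∈ levelSet p 2 1 := by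
  have e : (fun g => F (a * g * b)) = fun g =>
      fib ((b : Mat p 2).mulVec ![0, 1]) (((a⁻¹ : GLm p 2) : Mat p 2).mulVec ![0, 1]) g +
      ∑ x : ZMod p, (fib ((b : Mat p 2).mulVec (ux x)) (((a⁻¹ : GLm p 2) : Mat p 2).mulVec (ux x)) g
        + (-1) * fib ((b : Mat p 2).mulVec (ux x)) (((a⁻¹ : GLm p 2) : Mat p 2).mulVec ![1, 1]) g) := by
    funext g; simp only [F, fib_translate]
  rw [e]
  exact add_mem_levelSet (fib_mem _ _) (sum_mem_levelSet Finset.univ _ fun x _ =>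
    add_mem_levelSet (fib_mem _ _) (smul_mem_levelSet (fib_mem _ _) _))

/-- The lower unitriangular `h_t = (1,0; t−1,1)`. -/
def hLow (t : ZMod p) : GLm p 2 :=
  ⟨!![1, 0; t - 1, 1], !![1, 0; 1 - t, 1],
    by ext i j; fin_cases i <;> fin_cases j <;> simp [Matrix.mul_apply, Fin.sum_univ_two],
    by ext i j; fin_cases i <;> fin_cases j <;> simp [Matrix.mul_apply, Fin.sum_univ_two]⟩

/-- The matrix of `h_t`. -/
theorem hLow_val (t : ZMod p) : ((hLow t : GLm p 2) : Mat p 2) = !![1, 0; t - 1, 1] := rfl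

/-- The matrix of `h_t⁻¹`. -/
theorem hLow_inv_val (t : ZMod p) : (((hLow t)⁻¹ : GLm p 2) : Mat p 2) = !![1, 0; 1 - t, 1] := rfl

/-- The slice `S = {g : g₀₀ + g₀₁ = 1} = {g : (g w)₁ = 1}`. -/
def slice : Set (GLm p 2) := {g | (g : Mat p 2) 0 0 + (g : Mat p 2) 0 1 = 1}

/-- Membership in the slice, unfolded. -/
theorem mem_slice (g : GLm p 2) : g ∈ (slice : Set (GLm p 2)) ↔ (g : Mat p 2) 0 0 + (g : Mat p 2) 0 1 = 1 :=
  Iff.rfl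

/-- Membership in the slice is decidable (it is an equation in `ZMod p`). -/
instance (g : GLm p 2) : Decidable (g ∈ (slice : Set (GLm p 2))) :=
  inferInstanceAs (Decidable ((g : Mat p 2) 0 0 + (g : Mat p 2) 0 1 = 1))

/-- `t(s) = s₁₀ + s₁₁ = (s w)₂`. -/
def tOf (s : GLm p 2) : ZMod p := (s : Mat p 2) 1 0 + (s : Mat p 2) 1 1

/-- The conjugating map `T_s g = h⁻¹ g s⁻¹ h`, `h = h_{t(s)}`. -/
def T (s g : GLm p 2) : GLm p 2 := (hLow (tOf s))⁻¹ * g * (s⁻¹ * hLow (tOf s))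

/-- The point function `F ∘ T_s`. -/
noncomputable def Fpt (s g : GLm p 2) : ℂ := F (T s g)

/-- `T_s s = 1`. -/
theorem T_self (s : GLm p 2) : T s s = 1 := by unfold T; group

/-- `T_s g = 1` only for `g = s`. -/
theorem eq_of_T_eq_one (s g : GLm p 2) (h : T s g = 1) : g = s := by
  unfold T at h
  calc g = hLow (tOf s) * ((hLow (tOf s))⁻¹ * g * (s⁻¹ * hLow (tOf s))) * (hLow (tOf s))⁻¹ * s := by group
    _ = s := by rw [h]; group

/-- The slice condition is `(g w)₁ = 1`. -/
theorem mem_slice_iff (g : GLm p 2) : g ∈ (slice : Set (GLm p 2)) ↔ ((g : Mat p 2).mulVec ![1, 1]) 0 = 1 := by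
  simp [mem_slice]

/-- For `s ∈ S`: `s w = (1, t(s))ᵀ`. -/
theorem s_mulVec_w (s : GLm p 2) (hs : s ∈ (slice : Set (GLm p 2))) : (s : Mat p 2).mulVec ![1, 1] = ![1, tOf s] := by
  rw [mulVec_two, vec2_eq]; exact ⟨by simpa [mem_slice] using hs, by simp [tOf]⟩

/-- `h_t w = (1, t)ᵀ`. -/
theorem hLow_mulVec_w (t : ZMod p) : ((hLow t : GLm p 2) : Mat p 2).mulVec ![1, 1] = ![1, t] := by
  rw [hLow_val, mulVec_two, vec2_eq]; simp

/-- `T_s` maps the slice to the slice. -/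
theorem T_slice (s g : GLm p 2) (hs : s ∈ (slice : Set (GLm p 2))) (hg : g ∈ (slice : Set (GLm p 2))) : T s g ∈ (slice : Set (GLm p 2)) := by
  rw [mem_slice_iff, T, mulVec_mul3, Units.val_mul, ← Matrix.mulVec_mulVec, hLow_mulVec_w,
    ← (mulVec_eq_iff s _ _).1 (s_mulVec_w s hs), hLow_inv_val, mulVec_two, mulVec_two]
  simpa [mem_slice] using hg

/-- `F ∘ T_s` at `s` equals `p`. -/
theorem Fpt_self (s : GLm p 2) : Fpt s s = p := by rw [Fpt, T_self, F_one]

/-- `F ∘ T_s` vanishes on the rest of the slice. -/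
theorem Fpt_other (s g : GLm p 2) (hs : s ∈ (slice : Set (GLm p 2))) (hg : g ∈ (slice : Set (GLm p 2))) (hne : g ≠ s) : Fpt s g = 0 :=
  F_zero (T s g) (T_slice s g hs hg) (fun h => hne (eq_of_T_eq_one s g h))

/-- `F ∘ T_s` is a level-one function. -/
theorem Fpt_mem (s : GLm p 2) : (Fpt s : GLm p 2 → ℂ) ∈ levelSet p 2 1 := by
  have : (Fpt s : GLm p 2 → ℂ) = fun g => F ((hLow (tOf s))⁻¹ * g * (s⁻¹ * hLow (tOf s))) := rfl
  rw [this]; exact F_translate_mem _ _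

/-- **INTERPOLATION THEOREM.**  Every complex function on the slice `S = {g ∈ GL₂(𝔽_p) : g₀₀ + g₀₁ = 1}` is the
restriction of a level-one function (for every prime `p`). -/
theorem slice_interpolation (φ : GLm p 2 → ℂ) :
    ∃ f ∈ levelSet p 2 1, ∀ g : GLm p 2, (g : Mat p 2) 0 0 + (g : Mat p 2) 0 1 = 1 → f g = φ g := by
  classical
  refine ⟨fun g => ∑ s : GLm p 2, (if s ∈ (slice : Set (GLm p 2)) then φ s * (p : ℂ)⁻¹ else 0) * Fpt s g, ?_, ?_⟩
  · exact sum_mem_levelSet Finset.univ _ fun s _ => smul_mem_levelSet (Fpt_mem s) _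
  · intro g hg
    have hg' : g ∈ (slice : Set (GLm p 2)) := hg
    show ∑ s : GLm p 2, (if s ∈ (slice : Set (GLm p 2)) then φ s * (p : ℂ)⁻¹ else 0) * Fpt s g = φ g
    rw [Finset.sum_eq_single g]
    · rw [if_pos hg', Fpt_self, mul_assoc, inv_mul_cancel₀ (Nat.cast_ne_zero.mpr hp.out.ne_zero : (p : ℂ) ≠ 0), mul_one]
    · intro s _ hs
      by_cases hS : s ∈ (slice : Set (GLm p 2))
      · rw [Fpt_other s g hS hg' (Ne.symm hs), mul_zero]
      · rw [if_neg hS, zero_mul]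
    · intro h; exact absurd (Finset.mem_univ g) h

/-- **NO GHOST ON THE SLICE.**  A linear functional supported on the slice that annihilates every level-one
function is zero ("the evaluation functionals at the points of `S` are linearly independent on `F₁`"; full row
rank `|S| = p²(p−1)` — kit j078065 checked `p ≤ 23` numerically). -/
theorem annihilator_trivial (lam : GLm p 2 → ℂ)
    (hsupp : ∀ g : GLm p 2, (g : Mat p 2) 0 0 + (g : Mat p 2) 0 1 ≠ 1 → lam g = 0)
    (hann : ∀ f ∈ levelSet p 2 1, ∑ g : GLm p 2, lam g * f g = 0) : lam = 0 := by
  classical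
  funext g₀
  by_cases h₀ : (g₀ : Mat p 2) 0 0 + (g₀ : Mat p 2) 0 1 = 1
  · obtain ⟨f, hf, hfS⟩ := slice_interpolation (p := p) (fun g => if g = g₀ then 1 else 0)
    have := hann f hf
    rw [Finset.sum_eq_single g₀] at this
    · rw [hfS g₀ h₀, if_pos rfl, mul_one] at this; exact this
    · intro g _ hg
      by_cases hgS : (g : Mat p 2) 0 0 + (g : Mat p 2) 0 1 = 1
      · rw [hfS g hgS, if_neg hg, mul_zero]
      · rw [hsupp g hgS, zero_mul]
    · intro h; exact absurd (Finset.mem_univ g₀) h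
  · exact hsupp g₀ h₀

/-- **IDENTITY DESIGNS FOR EVERY TRIPLE INSIDE THE SLICE.**  If all products `abg` (`a ∈ H₁, b ∈ H₂, g ∈ H₃`) lie on
the slice `{g : g₀₀ + g₀₁ = 1}`, then the identity-design clause of the crux `SubgroupIdentityDesigns` holds at
level `k = 1` literally (a coefficient table `c` vanishing on rank `> 1` with `Σ_M c_M ψ(tr(M)) = 1` and
`Σ_M c_M ψ(tr(M·abg)) = 0` for `abg ≠ 1`).  This removes the shape hypotheses of
`FamilyADesign.levelOne_design_of_slice` (first row `(1,0)`, `H₂ ⊆ {1,r}`, `H₃ ⊆ Stab(w)`): only the location of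
the product set matters.  VALUE = theorem, NOT summit progress. -/
theorem design_of_products_in_slice {H₁ H₂ H₃ : Subgroup (Matrix.GeneralLinearGroup (Fin 2) (ZMod p))}
    (h : ∀ a ∈ H₁, ∀ b ∈ H₂, ∀ g ∈ H₃,
      ((a * b * g : Matrix.GeneralLinearGroup (Fin 2) (ZMod p)) : Matrix (Fin 2) (Fin 2) (ZMod p)) 0 0 +
        ((a * b * g : Matrix.GeneralLinearGroup (Fin 2) (ZMod p)) : Matrix (Fin 2) (Fin 2) (ZMod p)) 0 1 = 1) :
    ∃ c : Matrix (Fin 2) (Fin 2) (ZMod p) → ℂ, (∀ M, 1 < M.rank → c M = 0) ∧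
      (∑ M : Matrix (Fin 2) (Fin 2) (ZMod p), c M * ZMod.stdAddChar (Matrix.trace
        (M * ((1 : Matrix.GeneralLinearGroup (Fin 2) (ZMod p)) : Matrix (Fin 2) (Fin 2) (ZMod p))))) = 1 ∧
      ∀ a ∈ H₁, ∀ b ∈ H₂, ∀ g ∈ H₃, a * b * g ≠ 1 →
        (∑ M : Matrix (Fin 2) (Fin 2) (ZMod p), c M * ZMod.stdAddChar (Matrix.trace
          (M * ((a * b * g : Matrix.GeneralLinearGroup (Fin 2) (ZMod p)) :
            Matrix (Fin 2) (Fin 2) (ZMod p))))) = 0 := by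
  classical
  obtain ⟨f, hf, hfS⟩ := slice_interpolation (p := p) (fun g => if g = 1 then 1 else 0)
  obtain ⟨c, hc, hcf⟩ := hf
  refine ⟨c, hc, ?_, ?_⟩
  · show fourierFn c 1 = 1
    rw [← hcf 1, hfS 1 (by simp), if_pos rfl]
  · intro a ha b hb g hg hne
    show fourierFn c (a * b * g) = 0
    rw [← hcf _, hfS _ (h a ha b hb g hg), if_neg hne]

end FamilyAInterp
end Summit.MatrixMultiplication.MatrixMultiplication.Theorems.SubgroupIdentityDesigns.Negative
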